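import Mathlib.RingTheory.RegularLocalRing.Polynomial
import Mathlib.RingTheory.Localization.LocalizationLocalization
import Mathlib.RingTheory.Localization.AtPrime.Basic
import Mathlib.FieldTheory.IsAlgClosed.Basic
import Summits.ResolutionOfSingularities.ResolutionOfSingularities.Theorems.FrobeniusLadderFInjectiveMacaulayficationSopFrobeniusPower
import Summits.ResolutionOfSingularities.ResolutionOfSingularities.Theorems.FrobeniusLadderFInjectiveMacaulayficationQuotLocalizationIso
import Summits.ResolutionOfSingularities.ResolutionOfSingularities.Theorems.FrobeniusLadderFInjectiveMacaulayficationPolynomialLocalizationClauseAtPrime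
import Summits.ResolutionOfSingularities.ResolutionOfSingularities.Theorems.FrobeniusLadderFInjectiveMacaulayficationClauseLocalizes
import Summits.ResolutionOfSingularities.ResolutionOfSingularities.Theorems.FrobeniusLadderFInjectiveMacaulayficationPencilBlowupLocalCharts
import HarnessLib

/-!
# FULL of the pencil chart rings `B[X]/(uX − v)` over a REGULAR local base `B`, by Fedder's test read on two coefficients
# (BED Ω₁ GLOBAL PATCH, F6 v2 §2: the local rings of `S″ = Bl_{(L³+(ḡ)L²)K″} X` at points over `x̃ ∈ X̃₂` are localizations of `B[X]/(ūX − v̄)`, `B = 𝒪_{X̃₂,x̃}` regular;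
# crux `FInjectiveMacaulayfication` stmt-ResolutionOfSingularities-15315, chain w45a; seat res-L1-w45a-stub-3 g15)

[OURS · L1 W4.5a] Support file (`--supports stmt-ResolutionOfSingularities-15315 --as helper`); theorems only; GENERIC commutative algebra; no named fact; NOT a statement of any
manuscript; nothing of the crux is proved. AI-written (AI review is weaker than expert review).

For a local ring `(B, 𝔪)` of characteristic `p`, `u, v, w₀ ∈ B`, `f := C u·X − C v ∈ B[X]` and the point ideal `Q′ = 𝔪B[X] + (X − w₀)`:
* §1–§2 bookkeeping: `𝔪^[p]` of `Q′` is `𝔪^[p]B[X] + ((X − w₀)^p)`; after the shift `X ↦ X + w₀` its elements have all coefficients of degree `< p` in `𝔪^[p]`;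
* ★ `pencil_pow_not_mem_frobeniusPower_pointIdeal` — if `(u w₀ − v)^(p−1) ∉ 𝔪^[p]` (constant coefficient) OR `u^(p−1) ∉ 𝔪^[p]` (top coefficient) then `f^(p−1) ∉ Q′^[p]`;
* ★ `not_mem_frobeniusPower_localization` — Fedder non-membership passes to the localization at a maximal ideal;
* ★★ `fullCl_localization_pencilQuot_pointIdeal` — for `B` REGULAR local: the localization of `B[X]/(f)` at a prime over `Q′` is `FullCl p` (✓ `Fedder.fedder_criterion` in the regular local
  ring `B[X]_{Q′}`, ✓ `stub_quotLocalizationIso`, `IsDomain` supplied by the caller), and ★★ `fullCl_localization_pencilQuot_of_over` — the same at EVERY prime over `𝔪` when the residue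
  field is algebraically closed (primes over `𝔪` are `𝔪B[X]` — a localization of the point `w₀ = 0` — or point ideals).
[cite: Fedder1983, Prop. 1.7, Thm. 1.12; StacksProject, Tag 00OF]
-/

set_option linter.dupNamespace false

noncomputable section

namespace Summit.ResolutionOfSingularities.ResolutionOfSingularities.Theorems.FInjectiveMacaulayfication.PencilFedderRegularBase

open IsLocalRing Polynomial Literature.RingTheory.TightClosure Literature.AlgebraicGeometry.Resolution
open Summit.ResolutionOfSingularities.ResolutionOfSingularities.Theorems.FInjectiveMacaulayfication SliceableCentre

variable (p : ℕ) [Fact p.Prime]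

/-! ## §1 Polynomial bookkeeping -/

section Poly

variable {B : Type} [CommRing B]

/-- Top coefficient: `((uX + c)^n).coeff n = u^n`. [folklore] -/
theorem coeff_linear_pow_self (u c : B) (n : ℕ) : ((C u * X + C c) ^ n).coeff n = u ^ n := by
  have h := coeff_pow_of_natDegree_le (p := C u * X + C c) (n := 1) (m := n) natDegree_linear_le
  rw [mul_one] at h
  rw [h, coeff_add, coeff_C_mul_X, coeff_C, if_pos rfl, if_neg one_ne_zero, add_zero]

/-- Constant coefficient: `((uX + c)^n).coeff 0 = c^n`. [folklore] -/
theorem coeff_linear_pow_zero (u c : B) (n : ℕ) : ((C u * X + C c) ^ n).coeff 0 = c ^ n := by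
  rw [coeff_zero_eq_eval_zero, eval_pow, eval_add, eval_mul, eval_C, eval_X, eval_C, mul_zero, zero_add]

/-- In characteristic `p`: `(I + J)^[p] = I^[p] + J^[p]`. [folklore] -/
theorem frobeniusPower_sup [CharP B p] (I J : Ideal B) : frobeniusPower p (I ⊔ J) = frobeniusPower p I ⊔ frobeniusPower p J := by
  have h := fun K : Ideal B => frobeniusPower_eq_map_iterateFrobenius (R := B) p 1 K
  simp only [pow_one] at h
  rw [h, h, h, Ideal.map_sup]

/-- `(y)^[p] = (y^p)`. [folklore] -/
theorem frobeniusPower_span_singleton [CharP B p] (y : B) : frobeniusPower p (Ideal.span {y}) = Ideal.span {y ^ p} := by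
  have h := frobeniusPower_span (R := B) p 1 {y}
  rw [pow_one] at h
  rw [h, Set.image_singleton]

/-- Elements of `I·B[X] + (X^n)` have their coefficients of degree `< n` in `I`. [folklore] -/
theorem coeff_mem_of_mem_map_C_sup (I : Ideal B) (n : ℕ) (g : B[X]) (hg : g ∈ I.map (C : B →+* B[X]) ⊔ Ideal.span {X ^ n}) (d : ℕ) (hd : d < n) :
    g.coeff d ∈ I := by
  obtain ⟨a, ha, b, hb, rfl⟩ := Submodule.mem_sup.mp hg
  obtain ⟨r, rfl⟩ := Ideal.mem_span_singleton'.mp hb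
  rw [coeff_add, mul_comm, coeff_X_pow_mul', if_neg (not_le.mpr hd), add_zero]
  exact (Ideal.mem_map_C_iff.mp ha) d

end Poly

/-! ## §2 The point ideal `Q′ = 𝔪B[X] + (X − w₀)` and its Frobenius power -/

section Point

variable {B : Type} [CommRing B]

/-- `(I·B[X] + (X − w₀))^[p] = I^[p]·B[X] + ((X − w₀)^p)`. [folklore] -/
theorem frobeniusPower_pointIdeal [CharP B p] (I : Ideal B) (w₀ : B) :
    frobeniusPower p (I.map (C : B →+* B[X]) ⊔ Ideal.span {X - C w₀}) = (frobeniusPower p I).map (C : B →+* B[X]) ⊔ Ideal.span {(X - C w₀) ^ p} := by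
  have h := Fedder.frobeniusPower_map p (C : B →+* B[X]) 1 I
  rw [pow_one] at h
  rw [frobeniusPower_sup, frobeniusPower_span_singleton, h]

/-- The shift `σ : X ↦ X + w₀` sends `I·B[X] + ((X − w₀)^n)` to `I·B[X] + (X^n)`. [folklore] -/
theorem map_shift_pointIdeal_pow (I : Ideal B) (w₀ : B) (n : ℕ) :
    (I.map (C : B →+* B[X]) ⊔ Ideal.span {(X - C w₀) ^ n}).map ((algEquivAevalXAddC w₀ : B[X] ≃ₐ[B] B[X]) : B[X] →+* B[X]) =
      I.map (C : B →+* B[X]) ⊔ Ideal.span {X ^ n} := by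
  rw [Ideal.map_sup, Ideal.map_map, Ideal.map_span, Set.image_singleton]
  have h1 : ((algEquivAevalXAddC w₀ : B[X] ≃ₐ[B] B[X]) : B[X] →+* B[X]).comp C = C := by
    ext b
    simp [algEquivAevalXAddC]
  have h2 : ((algEquivAevalXAddC w₀ : B[X] ≃ₐ[B] B[X]) : B[X] →+* B[X]) ((X - C w₀) ^ n) = X ^ n := by
    simp [algEquivAevalXAddC]
  rw [h1, h2]

/-- The shift sends the pencil `uX − v` to `uX + (u w₀ − v)`. [plumbing] -/
theorem shift_pencil (u v w₀ : B) :
    ((algEquivAevalXAddC w₀ : B[X] ≃ₐ[B] B[X]) : B[X] →+* B[X]) (C u * X - C v) = C u * X + C (u * w₀ - v) := by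
  simp [algEquivAevalXAddC, map_sub, map_mul]
  ring

/-- ★ **Fedder's test for the pencil at a point of the fibre line, read on two coefficients**: if the constant coefficient `(u w₀ − v)^(p−1)` or the top coefficient `u^(p−1)` of
`(uX′ + (uw₀ − v))^(p−1)` (`X′ = X − w₀`) lies outside `𝔪^[p]`, then `(uX − v)^(p−1) ∉ (𝔪B[X] + (X − w₀))^[p]`. [cite: Fedder1983, Prop. 1.7] -/
theorem pencil_pow_not_mem_frobeniusPower_pointIdeal [CharP B p] (I : Ideal B) (u v w₀ : B)
    (h : (u * w₀ - v) ^ (p - 1) ∉ frobeniusPower p I ∨ u ^ (p - 1) ∉ frobeniusPower p I) :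
    (C u * X - C v) ^ (p - 1) ∉ frobeniusPower p (I.map (C : B →+* B[X]) ⊔ Ideal.span {X - C w₀}) := by
  intro hmem
  rw [frobeniusPower_pointIdeal] at hmem
  set σ : B[X] →+* B[X] := ((algEquivAevalXAddC w₀ : B[X] ≃ₐ[B] B[X]) : B[X] →+* B[X]) with hσ
  have hmem' : σ ((C u * X - C v) ^ (p - 1)) ∈ ((frobeniusPower p I).map (C : B →+* B[X]) ⊔ Ideal.span {(X - C w₀) ^ p}).map σ :=
    Ideal.mem_map_of_mem σ hmem
  rw [hσ, map_shift_pointIdeal_pow, map_pow, shift_pencil] at hmem'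
  have hp : p - 1 < p := Nat.sub_lt (Fact.out : p.Prime).pos one_pos
  rcases h with h0 | htop
  · apply h0
    have := coeff_mem_of_mem_map_C_sup (frobeniusPower p I) p _ hmem' 0 (Fact.out : p.Prime).pos
    rwa [coeff_linear_pow_zero] at this
  · apply htop
    have := coeff_mem_of_mem_map_C_sup (frobeniusPower p I) p _ hmem' (p - 1) hp
    rwa [coeff_linear_pow_self] at this

variable [IsLocalRing B]

/-- The point ideal `𝔪B[X] + (X − w₀)` is the kernel of `B[X] → k`, `g ↦ g(w₀) mod 𝔪`. [folklore] -/
theorem pointIdeal_eq_ker (w₀ : B) :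
    (maximalIdeal B).map (C : B →+* B[X]) ⊔ Ideal.span {X - C w₀} = RingHom.ker ((residue B).comp (evalRingHom w₀)) := by
  apply le_antisymm
  · refine sup_le (Ideal.map_le_iff_le_comap.mpr fun m hm => ?_) ((Ideal.span_singleton_le_iff_mem _).mpr ?_)
    · rw [Ideal.mem_comap, RingHom.mem_ker, RingHom.comp_apply, coe_evalRingHom, eval_C, residue_eq_zero_iff]
      exact hm
    · rw [RingHom.mem_ker, RingHom.comp_apply, coe_evalRingHom, eval_sub, eval_X, eval_C, sub_self, map_zero]
  · intro g hg
    rw [RingHom.mem_ker, RingHom.comp_apply, coe_evalRingHom, residue_eq_zero_iff] at hg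
    have hdvd : X - C w₀ ∣ g - C (eval w₀ g) := by
      rw [dvd_iff_isRoot]; simp
    obtain ⟨q, hq⟩ := hdvd
    have : g = C (eval w₀ g) + (X - C w₀) * q := by rw [← hq]; ring
    rw [this]
    exact Ideal.add_mem _ (Ideal.mem_sup_left (Ideal.mem_map_of_mem _ hg)) (Ideal.mem_sup_right (Ideal.mul_mem_right _ _ (Ideal.mem_span_singleton_self _)))

/-- The point ideal is maximal. [folklore] -/
theorem isMaximal_pointIdeal (w₀ : B) : ((maximalIdeal B).map (C : B →+* B[X]) ⊔ Ideal.span {X - C w₀}).IsMaximal := by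
  rw [pointIdeal_eq_ker]
  refine RingHom.ker_isMaximal_of_surjective _ fun x => ?_
  obtain ⟨b, rfl⟩ := residue_surjective x
  exact ⟨C b, by simp⟩

/-- The point ideal lies over `𝔪`. [folklore] -/
theorem comap_C_pointIdeal (w₀ : B) : ((maximalIdeal B).map (C : B →+* B[X]) ⊔ Ideal.span {X - C w₀}).comap C = maximalIdeal B := by
  rw [pointIdeal_eq_ker, ← RingHom.comap_ker, Ideal.comap_comap]
  ext b
  simp only [Ideal.mem_comap, RingHom.mem_ker, RingHom.comp_apply, coe_evalRingHom, eval_C, residue_eq_zero_iff]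

/-- The pencil lies in the point ideal as soon as `u, v ∈ 𝔪`. [plumbing] -/
theorem pencil_mem_pointIdeal (u v w₀ : B) (hu : u ∈ maximalIdeal B) (hv : v ∈ maximalIdeal B) :
    C u * X - C v ∈ (maximalIdeal B).map (C : B →+* B[X]) ⊔ Ideal.span {X - C w₀} :=
  Ideal.mem_sup_left (Ideal.sub_mem _ (Ideal.mul_mem_right _ _ (Ideal.mem_map_of_mem _ hu)) (Ideal.mem_map_of_mem _ hv))

end Point

/-! ## §3 Fedder non-membership passes to the localization at a maximal ideal -/

section Loc

/-- `Q′^[p]` is `Q′`-primary for a maximal ideal `Q′` of a ring of characteristic `p`. [folklore] -/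
theorem isPrimary_frobeniusPower_of_isMaximal {A : Type} [CommRing A] [CharP A p] (Q' : Ideal A) [hQ' : Q'.IsMaximal] :
    (frobeniusPower p Q').IsPrimary := by
  have hrad : (frobeniusPower p Q').radical = Q' := by
    refine le_antisymm ?_ fun x hx => ⟨p, pow_mem_frobeniusPower hx⟩
    refine (Ideal.IsPrime.radical_le_iff hQ'.isPrime).mpr (frobeniusPower_le (Fact.out : p.Prime).ne_zero Q')
  exact Ideal.isPrimary_of_isMaximal_radical (by rw [hrad]; exact hQ')

/-- ★ If `g ∉ Q′^[p]` for a maximal ideal `Q′`, then `g/1 ∉ 𝔫^[p]` in the localization `A_{Q′}` (`𝔫 = Q′A_{Q′}`). [folklore; cite: StacksProject, Tag 00OF] -/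
theorem not_mem_frobeniusPower_localization {A : Type} [CommRing A] [CharP A p] (Q' : Ideal A) [hQ' : Q'.IsMaximal] (g : A)
    (hg : g ∉ frobeniusPower p Q') :
    algebraMap A (Localization.AtPrime Q') g ∉ frobeniusPower p (maximalIdeal (Localization.AtPrime Q')) := by
  haveI : CharP (Localization.AtPrime Q') p := FrobeniusClosedLocalizes.charP_localizationAtPrime p Q'
  intro h
  rw [← Localization.AtPrime.map_eq_maximalIdeal] at h
  have hfm := Fedder.frobeniusPower_map p (algebraMap A (Localization.AtPrime Q')) 1 Q'
  rw [pow_one] at hfm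
  rw [hfm, IsLocalization.algebraMap_mem_map_algebraMap_iff Q'.primeCompl] at h
  obtain ⟨s, hs, hsg⟩ := h
  have hprim := Ideal.isPrimary_iff.mp (isPrimary_frobeniusPower_of_isMaximal p Q')
  rcases hprim.2 (by rw [mul_comm] at hsg; exact hsg) with h1 | h2
  · exact hg h1
  · have hrad : (frobeniusPower p Q').radical ≤ Q' :=
      (Ideal.IsPrime.radical_le_iff hQ'.isPrime).mpr (frobeniusPower_le (Fact.out : p.Prime).ne_zero Q')
    exact hs (hrad h2)

/-- ★ FULL passes from `T_{Q₀}` to `T_Q` for primes `Q ≤ Q₀` (`T_Q` is a localization of `T_{Q₀}`; ✓ `ClauseLocalizes.fiClause_localization`). [folklore; cite: StacksProject, Tag 02C5] -/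
theorem fullCl_localization_of_le {T : Type} [CommRing T] [IsNoetherianRing T] [CharP T p] (Q Q₀ : Ideal T) [Q.IsPrime] [Q₀.IsPrime] (hle : Q ≤ Q₀)
    (h : FullCl p (Localization.AtPrime Q₀)) : FullCl p (Localization.AtPrime Q) := by
  have hdisj : Disjoint (Q₀.primeCompl : Set T) (Q : Set T) := by
    rw [Set.disjoint_left]; intro x hx hxQ; exact hx (hle hxQ)
  obtain ⟨P, hPp, hPdef⟩ : ∃ P : Ideal (Localization.AtPrime Q₀), P.IsPrime ∧ P = Q.map (algebraMap T (Localization.AtPrime Q₀)) :=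
    ⟨_, IsLocalization.isPrime_of_isPrime_disjoint Q₀.primeCompl (Localization.AtPrime Q₀) Q ‹_› hdisj, rfl⟩
  haveI := hPp
  have hPc : P.comap (algebraMap T (Localization.AtPrime Q₀)) = Q := by
    rw [hPdef]; exact IsLocalization.under_map_of_isPrime_disjoint Q₀.primeCompl (Localization.AtPrime Q₀) ‹_› hdisj
  haveI : IsNoetherianRing (Localization.AtPrime Q₀) := IsLocalization.isNoetherianRing Q₀.primeCompl (Localization.AtPrime Q₀) inferInstance
  haveI : CharP (Localization.AtPrime Q₀) p := FrobeniusClosedLocalizes.charP_localizationAtPrime p Q₀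
  have hfullP : FullCl p (Localization.AtPrime P) := ClauseLocalizes.fiClause_localization p h P
  haveI hT : IsLocalization.AtPrime (Localization.AtPrime P) (P.comap (algebraMap T (Localization.AtPrime Q₀))) :=
    IsLocalization.isLocalization_isLocalization_atPrime_isLocalization Q₀.primeCompl (Localization.AtPrime P) P
  have hM : (P.comap (algebraMap T (Localization.AtPrime Q₀))).primeCompl = Q.primeCompl := by
    ext x
    change x ∉ P.comap (algebraMap T (Localization.AtPrime Q₀)) ↔ x ∉ Q
    rw [hPc]
  have hT' : IsLocalization Q.primeCompl (Localization.AtPrime P) := by rw [← hM]; exact hT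
  exact PencilBlowupLocalCharts.fullCl_of_ringEquiv' p (IsLocalization.algEquiv Q.primeCompl (Localization.AtPrime P) (Localization.AtPrime Q)).toRingEquiv hfullP

end Loc


/-! ## §4 FULL of the localizations of `B[X]/(uX − v)` over a regular local base -/

section Regular

variable {B : Type} [CommRing B] [IsRegularLocalRing B] [CharP B p]

omit [IsRegularLocalRing B] [CharP B p] in
/-- The pencil is nonzero as soon as one of the two Fedder coefficients lies outside `𝔪^[p]`. [plumbing] -/
theorem pencil_ne_zero [IsLocalRing B] (u v w₀ : B)
    (hfed : (u * w₀ - v) ^ (p - 1) ∉ frobeniusPower p (maximalIdeal B) ∨ u ^ (p - 1) ∉ frobeniusPower p (maximalIdeal B)) :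
    (C u * X - C v : B[X]) ≠ 0 := by
  have hp1 : p - 1 ≠ 0 := by have := (Fact.out : p.Prime).two_le; omega
  intro h
  have hu : u = 0 := by
    have := congrArg (fun g : B[X] => g.coeff 1) h
    simpa using this
  have hv : v = 0 := by
    have := congrArg (fun g : B[X] => g.coeff 0) h
    simpa using this
  rw [hu, hv, zero_mul, sub_zero, zero_pow hp1] at hfed
  rcases hfed with h | h <;> exact h (Ideal.zero_mem _)

/-- ★ **CORE: FULL FROM FEDDER'S TEST AT A MAXIMAL IDEAL OF `B[X]` OVER `𝔪`.** `B` regular local of characteristic `p`, `Q′` a maximal ideal of `B[X]` over `𝔪`, `0 ≠ f ∈ Q′` with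
`f^(p−1) ∉ Q′^[p]`, `B[X]/(f)` a domain, `Q` a prime of `B[X]/(f)` over `Q′` ⇒ `(B[X]/(f))_Q` is `FullCl p` (✓ `Fedder.fedder_criterion` in the regular local ring `B[X]_{Q′}`, then
`B[X]_{Q′}/(f) ≅ (B[X]/(f))_Q`). [OURS · F6 v2 §2; cite: Fedder1983, Prop. 1.7, Thm. 1.12] -/
theorem fullCl_localization_quot_of_fedder (f : B[X]) (Q' : Ideal B[X]) [hQ'max : Q'.IsMaximal] (hQ'c : Q'.comap (C : B →+* B[X]) = maximalIdeal B)
    (hfQ' : f ∈ Q') (hf0 : f ≠ 0) (hfed : f ^ (p - 1) ∉ frobeniusPower p Q') (hdom : IsDomain (B[X] ⧸ Ideal.span {f}))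
    (Q : Ideal (B[X] ⧸ Ideal.span {f})) [Q.IsPrime] (hQ : Q.comap (Ideal.Quotient.mk (Ideal.span {f})) = Q') :
    FullCl p (Localization.AtPrime Q) := by
  haveI : IsDomain B := isDomain_of_isRegularLocalRing B
  haveI hreg : IsRegularLocalRing (Localization.AtPrime Q') := Polynomial.isRegularLocalRing_localization_atPrime_of_comap_eq_maximalIdeal B Q' hQ'c
  haveI : CharP (Localization.AtPrime Q') p := FrobeniusClosedLocalizes.charP_localizationAtPrime p Q'
  have hf₁m : algebraMap B[X] (Localization.AtPrime Q') f ∈ maximalIdeal _ := by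
    rw [← Localization.AtPrime.map_eq_maximalIdeal]
    exact Ideal.mem_map_of_mem _ hfQ'
  have hf₁0 : algebraMap B[X] (Localization.AtPrime Q') f ≠ 0 := fun h0 =>
    hf0 (IsLocalization.injective (Localization.AtPrime Q') Q'.primeCompl_le_nonZeroDivisors (by rw [map_zero]; exact h0))
  have hfed₁ : (algebraMap B[X] (Localization.AtPrime Q') f) ^ (p - 1) ∉ frobeniusPower p (maximalIdeal _) := by
    rw [← map_pow]
    exact not_mem_frobeniusPower_localization p Q' _ hfed
  have hclause := (Fedder.fedder_criterion p (Localization.AtPrime Q') _ hf₁m hf₁0).mpr hfed₁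
  obtain ⟨e⟩ := QuotLocalizationIso.stub_quotLocalizationIso B[X] f Q' Q hQ
  haveI : IsDomain (Localization.AtPrime Q) := IsLocalization.isDomain_localization Q.primeCompl_le_nonZeroDivisors
  exact ⟨inferInstance, DegreeZeroDescent.inlineClause_of_ringEquiv p e hclause⟩

/-- ★★ **FULL AT A POINT OF THE FIBRE LINE.** `B` regular local of characteristic `p`, `u, v ∈ 𝔪`, `f = uX − v`, `Q` a prime of `B[X]/(f)` over the point ideal `𝔪B[X] + (X − w₀)`;
if `(u w₀ − v)^(p−1) ∉ 𝔪^[p]` or `u^(p−1) ∉ 𝔪^[p]` (Fedder's test read on the constant / the top coefficient), and `B[X]/(f)` is a domain, then `(B[X]/(f))_Q` is `FullCl p`.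
[OURS · F6 v2 §2; cite: Fedder1983, Prop. 1.7, Thm. 1.12] -/
theorem fullCl_localization_pencilQuot_pointIdeal (u v w₀ : B) (hu : u ∈ maximalIdeal B) (hv : v ∈ maximalIdeal B)
    (hfed : (u * w₀ - v) ^ (p - 1) ∉ frobeniusPower p (maximalIdeal B) ∨ u ^ (p - 1) ∉ frobeniusPower p (maximalIdeal B))
    (hdom : IsDomain (B[X] ⧸ Ideal.span {C u * X - C v}))
    (Q : Ideal (B[X] ⧸ Ideal.span {C u * X - C v})) [Q.IsPrime]
    (hQ : Q.comap (Ideal.Quotient.mk (Ideal.span {C u * X - C v})) = (maximalIdeal B).map (C : B →+* B[X]) ⊔ Ideal.span {X - C w₀}) :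
    FullCl p (Localization.AtPrime Q) := by
  haveI hQ'max : ((maximalIdeal B).map (C : B →+* B[X]) ⊔ Ideal.span {X - C w₀}).IsMaximal := isMaximal_pointIdeal w₀
  exact fullCl_localization_quot_of_fedder p (C u * X - C v) _ (comap_C_pointIdeal w₀) (pencil_mem_pointIdeal u v w₀ hu hv)
    (pencil_ne_zero p u v w₀ hfed) (pencil_pow_not_mem_frobeniusPower_pointIdeal p (maximalIdeal B) u v w₀ hfed) hdom Q hQ

/-- Primes of `B[X]` over `𝔪` when the residue field is algebraically closed: `𝔪B[X]` or a point ideal `𝔪B[X] + (X − w₀)`. [folklore] -/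
theorem eq_map_C_or_exists_point [IsAlgClosed (ResidueField B)] (P : Ideal B[X]) [P.IsPrime]
    (hPc : P.comap (C : B →+* B[X]) = maximalIdeal B) :
    P = (maximalIdeal B).map (C : B →+* B[X]) ∨ ∃ w₀ : B, P = (maximalIdeal B).map (C : B →+* B[X]) ⊔ Ideal.span {X - C w₀} := by
  rcases PolynomialLocalizationClause.eq_map_C_or_exists_monic P hPc with h | ⟨g, hg, hgdeg, hP⟩
  · exact Or.inl h
  · right
    -- the image of `g` in `k[X]` is prime, hence linear
    set π : B[X] →+* (ResidueField B)[X] := mapRingHom (residue B) with hπ_def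
    have hπ : Function.Surjective π := Polynomial.map_surjective _ residue_surjective
    have hker : RingHom.ker π = (maximalIdeal B).map (C : B →+* B[X]) := by
      rw [hπ_def, ker_mapRingHom, ker_residue]
    have hkerP : RingHom.ker π ≤ P := by rw [hker, hP]; exact le_sup_left
    haveI hP' : (P.map π).IsPrime := Ideal.map_isPrime_of_surjective hπ hkerP
    have hmapP : P.map π = Ideal.span {π g} := by
      rw [hP, Ideal.map_sup, ← hker, Ideal.map_span, Set.image_singleton]
      rw [(Ideal.map_eq_bot_iff_le_ker π).mpr le_rfl, bot_sup_eq]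
    have hgπmonic : (π g).Monic := hg.map _
    have hgπ0 : π g ≠ 0 := hgπmonic.ne_zero
    have hprime : Prime (π g) := by
      rw [← Ideal.span_singleton_prime hgπ0, ← hmapP]; exact hP'
    have hdeg : (π g).degree = 1 := IsAlgClosed.degree_eq_one_of_irreducible (ResidueField B) hprime.irreducible
    have hnat : g.natDegree = 1 := by
      rw [← hg.natDegree_map (residue B)]
      exact natDegree_eq_of_degree_eq_some hdeg
    refine ⟨-g.coeff 0, ?_⟩
    rw [hP]
    congr 2
    rw [map_neg, sub_neg_eq_add]
    conv_lhs => rw [eq_X_add_C_of_natDegree_le_one hnat.le]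
    rw [show g.coeff 1 = 1 from by rw [← hnat]; exact hg, C_1, one_mul]

/-- ★★ **FULL AT EVERY PRIME OVER `𝔪`** (residue field algebraically closed): under the two-coefficient Fedder test at every `w₀` and `B[X]/(f)` a domain, `(B[X]/(f))_Q` is `FullCl p`
for every prime `Q` lying over `𝔪` — the point ideals by `fullCl_localization_pencilQuot_pointIdeal`, the generic point of the fibre line as a localization of the point `w₀ = 0`
(✓ `ClauseLocalizes.fiClause_localization`). [OURS · F6 v2 §2; cite: Fedder1983, Thm. 1.12; StacksProject, Tag 02C5] -/
theorem fullCl_localization_pencilQuot_of_over [IsAlgClosed (ResidueField B)] (u v : B) (hu : u ∈ maximalIdeal B) (hv : v ∈ maximalIdeal B)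
    (hfed : ∀ w₀ : B, (u * w₀ - v) ^ (p - 1) ∉ frobeniusPower p (maximalIdeal B) ∨ u ^ (p - 1) ∉ frobeniusPower p (maximalIdeal B))
    (hdom : IsDomain (B[X] ⧸ Ideal.span {C u * X - C v}))
    (Q : Ideal (B[X] ⧸ Ideal.span {C u * X - C v})) [Q.IsPrime]
    (hQ : (Q.comap (Ideal.Quotient.mk (Ideal.span {C u * X - C v}))).comap (C : B →+* B[X]) = maximalIdeal B) :
    FullCl p (Localization.AtPrime Q) := by
  haveI : IsDomain B := isDomain_of_isRegularLocalRing B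
  haveI : (Q.comap (Ideal.Quotient.mk (Ideal.span {C u * X - C v}))).IsPrime := Ideal.comap_isPrime _ Q
  rcases eq_map_C_or_exists_point (Q.comap (Ideal.Quotient.mk (Ideal.span {C u * X - C v}))) hQ with hgen | ⟨w₀, hw₀⟩
  · -- the generic point of the fibre line: localize the point `w₀ = 0`
    have hfQ₀' : C u * X - C v ∈ (maximalIdeal B).map (C : B →+* B[X]) ⊔ Ideal.span {X - C 0} := pencil_mem_pointIdeal u v 0 hu hv
    have hker : RingHom.ker (Ideal.Quotient.mk (Ideal.span {C u * X - C v})) ≤ (maximalIdeal B).map (C : B →+* B[X]) ⊔ Ideal.span {X - C 0} := by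
      rw [Ideal.mk_ker]; exact (Ideal.span_singleton_le_iff_mem _).mpr hfQ₀'
    haveI hQ₀'max : ((maximalIdeal B).map (C : B →+* B[X]) ⊔ Ideal.span {X - C 0}).IsMaximal := isMaximal_pointIdeal 0
    haveI hQ₀p : (((maximalIdeal B).map (C : B →+* B[X]) ⊔ Ideal.span {X - C 0}).map (Ideal.Quotient.mk (Ideal.span {C u * X - C v}))).IsPrime :=
      Ideal.map_isPrime_of_surjective Ideal.Quotient.mk_surjective hker
    have hQ₀c : (((maximalIdeal B).map (C : B →+* B[X]) ⊔ Ideal.span {X - C 0}).map (Ideal.Quotient.mk (Ideal.span {C u * X - C v}))).comap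
        (Ideal.Quotient.mk (Ideal.span {C u * X - C v})) = (maximalIdeal B).map (C : B →+* B[X]) ⊔ Ideal.span {X - C 0} := by
      rw [Ideal.comap_map_of_surjective _ Ideal.Quotient.mk_surjective, sup_eq_left]
      exact le_trans (fun z hz => hz) hker
    have hfull₀ := fullCl_localization_pencilQuot_pointIdeal p u v 0 hu hv (hfed 0) hdom _ hQ₀c
    obtain ⟨Q₀, hQ₀p', hQ₀def⟩ : ∃ Q₀ : Ideal (B[X] ⧸ Ideal.span {C u * X - C v}), Q₀.IsPrime ∧
        Q₀ = ((maximalIdeal B).map (C : B →+* B[X]) ⊔ Ideal.span {X - C 0}).map (Ideal.Quotient.mk (Ideal.span {C u * X - C v})) := ⟨_, hQ₀p, rfl⟩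
    haveI := hQ₀p'
    have hfull₀' : FullCl p (Localization.AtPrime Q₀) := by subst hQ₀def; exact hfull₀
    have hle : Q ≤ Q₀ := by
      have h1 : Q = (Q.comap (Ideal.Quotient.mk (Ideal.span {C u * X - C v}))).map (Ideal.Quotient.mk (Ideal.span {C u * X - C v})) :=
        (Ideal.map_comap_of_surjective _ Ideal.Quotient.mk_surjective Q).symm
      rw [h1, hgen, hQ₀def]
      exact Ideal.map_mono le_sup_left
    -- `(T)_Q` is a localization of `(T)_{Q₀}`
    haveI : CharP (B[X] ⧸ Ideal.span {C u * X - C v}) p :=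
      CharP.of_ringHom_of_ne_zero (Ideal.Quotient.mk (Ideal.span {C u * X - C v})) p (Fact.out : p.Prime).ne_zero
    exact fullCl_localization_of_le p Q Q₀ hle hfull₀'
  · exact fullCl_localization_pencilQuot_pointIdeal p u v w₀ hu hv (hfed w₀) hdom Q hw₀

end Regular

end Summit.ResolutionOfSingularities.ResolutionOfSingularities.Theorems.FInjectiveMacaulayfication.PencilFedderRegularBase

end
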